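import Literature.MathematicalPhysics.QuantumFieldTheory.ConformalBootstrap3D.PointKernelTM

/-!
# Kernel v3: from certified cells to block positivity — the per-cell contract of the instance

`PointKernelTM.headG_nonneg_of_cellNumber` turns a non-negative *cell number* (a `decide`d
integer computation on one s-piece of one Δ-cell `[A - h, A + h]`) into the `hpos` hypothesis of
`blockPositive_pointFunctional_of_headG_Ico`; `cell_of_headG_pieces` glues the s-pieces of a cell
and the tail.  This file packages the two into ONE statement per cell, with every side condition
either global (the s-box `Q`, the tail) or DECIDABLE (`chainOK`: the pieces tile `[slo, shi]`
exactly, read off the exponent requests in exact rational arithmetic), so that an instance file is a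
list of `decide` facts and one application of `blockPositive_of_cellPass` per cell:

* `CellPass c t p`      — some node partition has `PartsOK` and `0 ≤ cellNumber` (delivered by the
                           group theorems `gPart … = some g` and one `decide`);
* `chainOK c ps P slo shi` — `σ₀ = slo`, `σ_P = shi`, `σ_{i+1} = σ_i + δ_i`, `0 ≤ δ_i`, requests
                           within fuel, for the piece list `ps` (Bool);
* `blockPositive_of_cellPass` — for every `q ∈ Q` (with `slo ≤ q.1 ≤ shi`) and every
                           `Δ ∈ [a, b) ⊆ [A - h, A + h]` with `unitarityBound3D ℓ ≤ a`,
                           `ℓ + τ ≤ a`, `E₀ ≤ a + n_F + 1`: `BlockPositive (pointFunctional …) q.1 Δ ℓ`.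

References: the truncated-block positivity scheme of [cite: HogervorstRychkov2013, §3 eq. (3.6)];
rigorous Taylor-model enclosures [folklore].  No new analysis: bookkeeping over the two landed
theorems.
-/

namespace Literature.MathematicalPhysics.QuantumFieldTheory.ConformalBootstrap3D

namespace PKTM

open Set PointKernel

/-- The all-zero piece (default for list access). [folklore] -/
def TMPiece.zero : TMPiece := ⟨⟨0, 0, 0, 0, 0, 0⟩, ⟨0, 0, 0, 0, 0, 0⟩⟩

/-- **A cell passes on the piece `p`**: some partition of the nodes into groups has Taylor models
(`PartsOK`) with a non-negative cell number. [folklore] -/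
def CellPass (c : PCert) (t : TMCell) (p : TMPiece) : Prop :=
  ∃ gs : List G3, PartsOK c t p 0 c.N gs ∧ 0 ≤ cellNumber c.S t.h gs

/-- Introduction rule used by the instance files. [folklore] -/
theorem cellPass_intro {c : PCert} {t : TMCell} {p : TMPiece} {gs : List G3}
    (hP : PartsOK c t p 0 c.N gs) (hnum : 0 ≤ cellNumber c.S t.h gs) : CellPass c t p :=
  ⟨gs, hP, hnum⟩

/-- The `i`-th piece of a piece list. [folklore] -/
def pc (ps : List TMPiece) (i : ℕ) : TMPiece := ps.getD i TMPiece.zero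

/-- **Exact piece chain** (decidable): the pieces `ps[0..P)` tile `[slo, shi]` —
`σ₀ = slo`, `σ_P = shi` (entry `P` is a sentinel carrying only `rSig`), `σ_i + δ_i = σ_{i+1}`,
`0 ≤ δ_i`, and all requests are within the power fuel. [folklore] -/
def chainOK (c : PCert) (ps : List TMPiece) (P : ℕ) (slo shi : ℚ) : Bool :=
  decide ((pc ps 0).rSig.expo c.rho = slo) && decide ((pc ps P).rSig.expo c.rho = shi) &&
    (List.range P).all fun i =>
      decide ((pc ps i).rSig.expo c.rho + (pc ps i).rDel.expo c.rho = (pc ps (i + 1)).rSig.expo c.rho)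
        && decide (0 ≤ (pc ps i).rDel.expo c.rho) && (pc ps i).rSig.ok && (pc ps i).rDel.ok

/-- Node coordinates of a checked certificate lie in `(0, 1)`. [folklore] -/
theorem zR_mem_Ioo {c : PCert} (hc : c.checkNodes = true) (k : Fin c.N) :
    c.zR k ∈ Ioo (0 : ℝ) 1 := by
  have hk := PCert.checkNode_of_checkNodes hc k.2
  exact ⟨by unfold PCert.zR; exact_mod_cast PCert.z_pos hk,
    by unfold PCert.zR; exact_mod_cast PCert.z_lt_one hk⟩

/-- Node coordinates of a checked certificate lie in `(0, 1)`. [folklore] -/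
theorem zbR_mem_Ioo {c : PCert} (hc : c.checkNodes = true) (k : Fin c.N) :
    c.zbR k ∈ Ioo (0 : ℝ) 1 := by
  have hk := PCert.checkNode_of_checkNodes hc k.2
  exact ⟨by unfold PCert.zbR; exact_mod_cast PCert.zb_pos hk,
    by unfold PCert.zbR; exact_mod_cast PCert.zb_lt_one hk⟩

/-- **The per-cell contract of the v3 instance.**  A cell `t` (centre `A`, half-width `h`) whose
s-pieces `ps[0..P)` tile `[slo, shi]` exactly (`chainOK`) and all pass (`CellPass`) yields block
positivity of the point functional for every `s ∈ [slo, shi]` occurring in `Q` and every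
`Δ ∈ [a, b) ⊆ [A - h, A + h]` above the unitarity bound, given the global tail hypothesis.
[cite: HogervorstRychkov2013, §3 eq. (3.6)] -/
theorem blockPositive_of_cellPass {c : PCert} (hc : c.checkNodes = true)
    {Q : Set (ℝ × ℝ)} {slo shi : ℚ} {E₀ τ : ℝ}
    (hQ : ∀ q ∈ Q, ((slo : ℚ) : ℝ) ≤ q.1 ∧ q.1 ≤ ((shi : ℚ) : ℝ))
    (htail : ∀ (j : ℕ) (E : ℝ), E₀ ≤ E → (j : ℝ) + τ ≤ E → (j : ℝ) ≤ E → ∀ q ∈ Q,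
      0 ≤ pointFunctional c.wR c.zR c.zbR (crossF q.1 (-1) (zMono E j)))
    {t : TMCell} (hD : 1 ≤ t.D) (hK : 0 < t.K) (hℓ : Even t.ℓ)
    (hpiv : HRTM.pivOK t.A t.ℓ t.e t.nF = true) (hrA : t.rA.ok = true)
    (hA : t.rA.expo c.rho = t.A / 2)
    {ps : List TMPiece} {P : ℕ} (hP : 0 < P) (hch : chainOK c ps P slo shi = true)
    (hpass : ∀ i < P, CellPass c t (pc ps i))
    {a b : ℝ} (ha : (t.A : ℝ) - t.h ≤ a) (hb : b ≤ (t.A : ℝ) + t.h)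
    (hnF : E₀ ≤ a + ((t.nF : ℝ) + 1)) (hbd : unitarityBound3D t.ℓ ≤ a)
    (haτ : (t.ℓ : ℝ) + τ ≤ a) :
    ∀ q ∈ Q, ∀ Δ ∈ Ico a b, BlockPositive (pointFunctional c.wR c.zR c.zbR) q.1 Δ t.ℓ := by
  simp only [chainOK, Bool.and_eq_true, decide_eq_true_eq, List.all_eq_true, List.mem_range] at hch
  obtain ⟨⟨h0, hPσ⟩, hall⟩ := hch
  let σ : ℕ → ℝ := fun i => expoR c (pc ps i).rSig
  have hδ : ∀ i < P, σ (i + 1) - σ i = expoR c (pc ps i).rDel := by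
    intro i hi
    obtain ⟨⟨⟨he, -⟩, -⟩, -⟩ := hall i hi
    simp only [σ, expoR, ← he]; push_cast; ring
  refine cell_of_headG_pieces c.wR c.zR c.zbR (zR_mem_Ioo hc) (zbR_mem_Ioo hc) hQ htail t.nF hnF
    hbd haτ σ P hP (by simp only [σ, expoR, h0]) (by simp only [σ, expoR, hPσ]) ?_ ?_
  · intro i hi
    obtain ⟨⟨⟨-, hd⟩, -⟩, -⟩ := hall i hi
    have := hδ i hi
    have hd' : (0 : ℝ) ≤ expoR c (pc ps i).rDel := by unfold expoR; exact_mod_cast hd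
    linarith
  · intro i hi Δ hΔ _ θ hθ
    obtain ⟨⟨⟨-, -⟩, hrS⟩, hrD⟩ := hall i hi
    obtain ⟨gs, hparts, hnum⟩ := hpass i hi
    rw [hδ i hi]
    exact headG_nonneg_of_cellNumber hc hD hK hℓ hpiv hrA hrS hrD hA hparts hnum Δ
      ⟨by linarith [hΔ.1], by linarith [hΔ.2]⟩ θ hθ

/-- One piece. [folklore] -/
theorem cellPass_one {c : PCert} {t : TMCell} {ps : List TMPiece} (h0 : CellPass c t (pc ps 0)) :
    ∀ i < 1, CellPass c t (pc ps i) := by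
  intro i hi; interval_cases i; exact h0

/-- Two pieces. [folklore] -/
theorem cellPass_two {c : PCert} {t : TMCell} {ps : List TMPiece} (h0 : CellPass c t (pc ps 0))
    (h1 : CellPass c t (pc ps 1)) : ∀ i < 2, CellPass c t (pc ps i) := by
  intro i hi; interval_cases i <;> assumption

/-- Four pieces. [folklore] -/
theorem cellPass_four {c : PCert} {t : TMCell} {ps : List TMPiece} (h0 : CellPass c t (pc ps 0))
    (h1 : CellPass c t (pc ps 1)) (h2 : CellPass c t (pc ps 2)) (h3 : CellPass c t (pc ps 3)) :
    ∀ i < 4, CellPass c t (pc ps i) := by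
  intro i hi; interval_cases i <;> assumption

end PKTM

end Literature.MathematicalPhysics.QuantumFieldTheory.ConformalBootstrap3D
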